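import Summits.KontsevichZagierPeriods.KontsevichZagierPeriods.Theorems.RootDecompRelativeModAbsoluteCylLogSplitP25
import Summits.KontsevichZagierPeriods.KontsevichZagierPeriods.Theorems.RootDecompRelativeModAbsoluteOneVarPowerBounds
import Summits.KontsevichZagierPeriods.KontsevichZagierPeriods.Theorems.RootDecompRelativeModAbsoluteCylKernelZeroP2
import Summits.KontsevichZagierPeriods.KontsevichZagierPeriods.Theorems.LogPrimitiveNL.Negative.Rigidity
import Literature.NumberTheory.Transcendental.SemialgebraicMonotonicityProofs
import Literature.ModelTheory.ExponentialFields.TarskiSeidenbergProofs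
import Literature.NumberTheory.Transcendental.SemialgebraicMaps
import Literature.NumberTheory.Transcendental.SemialgebraicLineDeriv
import Literature.NumberTheory.Transcendental.KZFibreMapMove
import Literature.NumberTheory.Transcendental.KZDominatedFamilyRelations

/-! # `RootDecompRelativeModAbsoluteCylLogSplitP26` — part 1/27 of the mechanical ≤400-line split of `RungClosure.lean` (sha256 f909f334226f0fb5…)
Source: decomp-kz lens-3 g12 `RungClosure.lean` v9 (HOME/decomp-kz-lens-3/g12/, sha256 f909f334…; critic g4-52/g4-57/g5 CLEARED, «lander: split v9 --supports 30572»): BLOCK I (57 g11 monolith decls missing from P01–P25), BLOCK II/III (WildCertAssembly parts 1–6, 8–10: `Leaf.cellLocalWildCert`, `Leaf.cylKernelZeroLog_of_trees`), Parts 12–13 (`Leaf.regKernelPairDegOne_iff_circlePos_of_trees`), BLOCK G13 (Möbius engine, test §C decided).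
Split by census-1 g9 `gen/splitlean.py`: scopes re-opened with their `open`/`variable`/`set_option` context; mathematics and declaration order unchanged. -/

/-!
# Cell `decomp-kz`, lens 3, generation 12 — `RungClosure`: the rung `CylKernelZeroLog` of item 30572, closed
# modulo the two TREE theorems `LogStructure` / `BoundaryRigidity`, in ONE kernel environment over the LANDED chain

The census landed the monolith `CylLogSplit.lean` as `Theorems/RootDecompRelativeModAbsoluteCylLogSplitP01–P25` from its
g10 text; the g11 insertions (v17–v20: §1 mixed kind, §3aa–§3am = `tameClose`, `wildClose`, `TameCell`, `zW`,
`WildCellCert`, `LocalWildCert`, `CellLocalWildCert`, the glue `cylKernelZeroLog_of_localWildCert`, the `TestB` instance,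
the sign pieces) are NOT in that chain.  This file = (BLOCK I) exactly those 57 missing declarations of the certified
monolith v20 (sha256 93b0488c…, critic-CLEARED g11), VERBATIM but for five occurrences of
`isSemialgebraicFunOn_apply` written fully qualified (`Literature.NumberTheory.Transcendental.…`; the extra Literature
imports of BLOCK II bring a homonym into scope), in their namespace `…CylLog`, elaborated against the
LANDED P01–P25 declarations; (BLOCK II) the g11 companions (Parts 1–6 of `WildCertAssembly.lean`, verbatim); (BLOCK III)
the new g12 mathematics (Parts 8–10 of `WildCertAssembly.lean`: Γ-lattice split, T3 `wildCellCert_of_pointwise`, T4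
`cellLocalWildCert`; Part 12: the sign dichotomy of the arctangent kind — `κ ≤ 0` arctangent terms are LOG KIND by
partial fractions, `cylKernelZeroMixedNonpos_of_log`; Part 13: sign cells + Part 12 on each cell ⟹ the residual is the PURE
POSITIVE CIRCLE KIND on open cells, `cylKernelZeroMixed_iff_circlePos_of_log : CylKernelZeroLog → (CylKernelZeroMixed ↔
CylKernelZeroCirclePos)`) in the sub-namespace `…CylLog.Leaf`, where `WildCellCert /
LocalWildCert / CellLocalWildCert / …` resolve to the BLOCK I declarations; and the corollaries
`Leaf.regKernelPairDegOne_iff_circlePos_of_trees : LogStructure → BoundaryRigidity → (RegKernelPairDegOne ↔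
CylKernelZeroCirclePos)` (the ITEM 30572 is, given the two tree theorems, EXACTLY the ONE residual `CylKernelZeroCirclePos`,
through the landed EQUIV) and

  `theorem Leaf.cylKernelZeroLog_of_trees (hLS : LogStructure) (hBR : …Negative.BoundaryRigidity) : CylKernelZeroLog`

whose conclusion is the LANDED rung statement `…CylLog.CylKernelZeroLog` (P01) and whose hypotheses are the LANDED
`…CylLog.LogStructure` (P01; = the tree structure theorem `AxSchanuelGerms.stub_structure` ∘ six landed stubs, carried by
statement because the farm snapshot does not build that module) and the tree's `Negative.BoundaryRigidity`
(`Theorems/LogPrimitiveNL/Negative/Rigidity.lean`; a tree theorem `boundaryRigidity_of_structure`).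
-/

noncomputable section

open Set MeasureTheory Filter Topology
open scoped BigOperators
open Literature.NumberTheory.Transcendental Literature.ModelTheory.ExponentialFields

/-! # BLOCK I — the 57 declarations of the monolith v20 not in the landed chain P01–P25 (verbatim) -/

namespace Summit.KontsevichZagierPeriods.RootDecompRelativeModAbsolute.Rung30571

namespace RegularisedLogLayer

namespace CylLog
variable {b : ℕ}

/-! ## BLOCK I-A — v20 §1, the mixed kind (v20 l.145–208) -/

/-! ### §1b THE KIND SPLIT OF `CylKernelZero` (generation 11; critic ruling CRITIC-LEDGER row g3-65, γ′):
`CylKernelZero ⟺ CylKernelZeroLog ∧ CylKernelZeroMixed` — an iff BY CASES on the honest structural parameter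
«does the family contain an arctangent-kind term (`∃ i, eᵢ = 2`)»; no EQUIV is spent (this is not a reformulation). -/

/-- **`CylKernelZeroMixed`** — the MIXED / ARCTANGENT KIND of `CylKernelZero`: the SAME quantifier block as
`CylKernelZero` with the one extra hypothesis `∃ i, e i = 2` (the family contains at least one arctangent-kind
kernel `θ^{Mᵢ}/(1+θ²κᵢ)`; the other terms may be of either kind, and the a.e.-vanishing hypothesis is on the SUM).
[tag: WEAKER than `CylKernelZero` (a specialisation, `cylKernelZeroMixed_of_cylKernelZero`), hence WEAKER than the
summit; together with `CylKernelZeroLog` EQUIVALENT to `CylKernelZero` (`cylKernelZero_iff_log_and_mixed`, a case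
split); UNDECIDED; what it needs is analysed in NODE-g11.md §M (circle structure theorem + regularised circle
calculus; on structure cells the log part and the arctangent part DECOUPLE)] -/
def CylKernelZeroMixed : Prop :=
  ∀ (P : Set (Fin 1 → ℝ)) (V : KZ.IntegralRep (1 + 1)) (a₀ : (Fin 1 → ℝ) → ℝ) (q : ℕ)
    (c κ : Fin q → (Fin 1 → ℝ) → ℝ) (M e : Fin q → ℕ),
    IsSemialgebraic ℚ P → IsSemialgebraicFunOn ℚ P a₀ → IntegrableOn a₀ P →
    (∀ i, IsSemialgebraicFunOn ℚ P (c i)) → (∀ i, IsSemialgebraicFunOn ℚ P (κ i)) →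
    (∀ i, e i = 1 ∨ e i = 2) → (∃ i, e i = 2) → (∀ i, ∀ x ∈ P, -1 < κ i x) →
    (∀ i, IntegrableOn (fun z : Fin (1 + 1) → ℝ =>
      c i (Fin.init z) * (z (Fin.last 1) ^ M i / (1 + z (Fin.last 1) ^ e i * κ i (Fin.init z))))
      {z : Fin (1 + 1) → ℝ | (Fin.init z : Fin 1 → ℝ) ∈ P ∧ z (Fin.last 1) ∈ Set.Ioo 0 1}) →
    (∀ i, IntegrableOn (fun x => c i x * ∫ θ in Set.Ioo (0 : ℝ) 1, θ ^ M i / (1 + θ ^ e i * κ i x)) P) →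
    V.domain = {z : Fin (1 + 1) → ℝ | (Fin.init z : Fin 1 → ℝ) ∈ P ∧ z (Fin.last 1) ∈ Set.Ioo 0 1} →
    Set.EqOn V.integrand (fun z => a₀ (Fin.init z) +
      ∑ i, c i (Fin.init z) * (z (Fin.last 1) ^ M i / (1 + z (Fin.last 1) ^ e i * κ i (Fin.init z))))
      V.domain →
    (∀ᵐ x : (Fin 1 → ℝ), x ∈ P →
      a₀ x + ∑ i, c i x * ∫ θ in Set.Ioo (0 : ℝ) 1, θ ^ M i / (1 + θ ^ e i * κ i x) = 0) →
    KZ.of V ∈ KZ.relations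

/-- **Edge (PROVED): `CylKernelZero ⟹ CylKernelZeroMixed`** — drop the extra hypothesis. -/
theorem cylKernelZeroMixed_of_cylKernelZero (hC : CylKernelZero) : CylKernelZeroMixed := by
  intro P V a₀ q c κ M e hP ha₀ ha₀i hc hκ he _ hκ1 hint hL1 hdom hV hae
  exact hC P V a₀ q c κ M e hP ha₀ ha₀i hc hκ he hκ1 hint hL1 hdom hV hae

/-- **Assembly of the kind split (PROVED): `CylKernelZeroLog ∧ CylKernelZeroMixed ⟹ CylKernelZero`** — case split on
`∃ i, e i = 2`; in the negative branch `e ≡ 1` by `funext` (from `∀ i, e i = 1 ∨ e i = 2`). -/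
theorem cylKernelZero_of_log_and_mixed (hL : CylKernelZeroLog) (hM : CylKernelZeroMixed) : CylKernelZero := by
  intro P V a₀ q c κ M e hP ha₀ ha₀i hc hκ he hκ1 hint hL1 hdom hV hae
  by_cases h2 : ∃ i, e i = 2
  · exact hM P V a₀ q c κ M e hP ha₀ ha₀i hc hκ he h2 hκ1 hint hL1 hdom hV hae
  · have he1 : e = fun _ => 1 := by
      funext i
      rcases he i with h | h
      · exact h
      · exact absurd ⟨i, h⟩ h2
    subst he1
    simp only [pow_one] at hint hL1 hV hae
    exact hL P V a₀ q c κ M hP ha₀ ha₀i hc hκ hκ1 hint hL1 hdom hV hae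

/-- **`CylKernelZero ⟺ CylKernelZeroLog ∧ CylKernelZeroMixed`** (PROVED; the glue lemma of the critic's γ′:
items L = `CylKernelZeroLog`, M = `CylKernelZeroMixed` beneath 30572, composed with the landed
`regKernelPairDegOne_iff_cylKernelZero`). -/
theorem cylKernelZero_iff_log_and_mixed : CylKernelZero ↔ CylKernelZeroLog ∧ CylKernelZeroMixed :=
  ⟨fun h => ⟨cylKernelZeroLog_of_cylKernelZero h, cylKernelZeroMixed_of_cylKernelZero h⟩,
    fun h => cylKernelZero_of_log_and_mixed h.1 h.2⟩

/- NOTE (g11 addendum 2; critic row g4-4, 2026-08-30): `CylKernelZeroMixed → CylKernelZero` also holds — pad any instance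
with ONE dummy arctan-kind term `(c, κ, M, e) := (0, 0, 0, 2)` — so the `iff` above is bookkeeping (`X ↔ (consequence of X) ∧ X`),
NOT a split into two necessary pieces; "the family contains an arctan term" is not invariant under zero-padding.  The
honest, padding-invariant objects of this file are the RUNG `CylKernelZeroLog` (absence-predicated: all `eᵢ = 1`), its typed
residual `CellLocalWildCert` (§3aj) and the proved ingredient `CellCloseLSTame` (§3ag/§3ah). -/

/-! ## §2 The two TREE inputs, by statement / by name -/

/- `fin3_cases` (v20 l.5507) is not re-declared publicly: the gate dedup lint identifies it with `Literature.RepresentationTheory.GeneralLinear.fin3_cases`; each part that needs it carries a `private` copy (landing edit by census-1 g9). -/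

/-! ## BLOCK I-C — v20 §3aa–§3am (l.5779–8153): `tameClose`, the typed tame/wild split, `wildClose`, `WildCellCert`,
`LocalWildCert`, `CellLocalWildCert`, the glue `cylKernelZeroLog_of_localWildCert`, `TestB`, §3al/§3am locality -/

/-! ### §3af THE TAME CLASS CLOSES — `tameClose` PROVED from `BoundaryRigidity` BY NAME (g11)
Blueprint steps 4 + 6 + 7 of NODE-g10 as ONE theorem.  A σ-oriented family of honest regularised cells
`P_i = [band_i, d_i (t−1)^{M_i}/t]` (`σ i`: band `[1, W_i]`, `W_i ≥ 1`; `¬σ i`: band `[W_i, 1]`, `0 < W_i ≤ 1`) over an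
open `ℚ`-sa base `G ⊆ ℝ^b`, whose coefficients satisfy the LOG IDENTITY `Σ_i (−1)^{M_i} d_i log W_i = 0` on `G` and the
TAMENESS bounds `d_i log W_i ∈ L¹(G)` (all `i`) and `d_i (W_i − 1)^{j+1} ∈ L¹(G)` (`σ i`, `j < M_i`), satisfies
`Σ_i ε_i [P_i] − [G, Σ_i d_i polyLog_{M_i}(W_i)] ∈ KZ.relations` (`ε_i = ±1` the orientation sign).
Mechanism: LOWER every cell TO ORDER 0 FIRST (order telescope §3ab with `M := 0`; the intermediate cells and base
terms are honest exactly by the tameness bounds — the reversed cells by the new log-criterion honesty lemma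
`exists_regRep_of_integrableOn_log'`), rescale the order-0 cells by `(−1)^{M_i}` (`of_zsmul_sub_mem_relations`), and
feed the pure-log family `U_i = [band_i, (−1)^{M_i} d_i/t]` to (R1) `r1_of_boundaryRigidity`; the signed base terms are
consolidated by `of_sub_sum_zsmul_mem_relations`.  NO splitting of coefficients along the relation lattice is needed
for a tame cell (the cross-term obstruction of NODE-g10 Addendum L only arises when degenerate indices force a split). -/

/-- `[S] − n•[R] ∈ KZ.relations` when `S = [D, n·f]` and `R = [D, f]` (`n : ℤ`). -/
theorem of_zsmul_sub_mem_relations {N : ℕ} (n : ℤ) (R S : KZ.IntegralRep N) (hd : S.domain = R.domain)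
    (hi : EqOn S.integrand (fun x => (n : ℝ) * R.integrand x) R.domain) :
    KZ.of S - n • KZ.of R ∈ KZ.relations := by
  -- the honest representation `[D, m·f]`
  let T : ℤ → KZ.IntegralRep N := fun m =>
    { domain := R.domain, integrand := fun x => (m : ℝ) * R.integrand x,
      isSemialgebraic_domain := R.isSemialgebraic_domain,
      isSemialgebraicFunOn_integrand :=
        (IsSemialgebraicFunOn.mul_holds (isSemialgebraicFunOn_ratCast R.isSemialgebraic_domain (m : ℚ))
          R.isSemialgebraicFunOn_integrand).congr fun x _ => by simp,
      integrableOn := R.integrableOn.const_mul (m : ℝ) }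
  have hT : ∀ m : ℤ, KZ.of (T m) - m • KZ.of R ∈ KZ.relations := by
    intro m
    induction m using Int.induction_on with
    | zero =>
      simp only [zero_smul, sub_zero]
      exact KZ.of_mem_relations_of_eqOn_zero (T 0) fun x _ => by simp [T]
    | succ m ih =>
      have h1 : KZ.of (T ((m : ℤ) + 1)) - KZ.of (T m) - KZ.of R ∈ KZ.relations :=
        KZ.integrandAddRel_subset_relations ⟨N, T ((m : ℤ) + 1), T m, R, rfl, rfl, fun x _ => by
          simp only [T, Pi.add_apply]; push_cast; ring, rfl⟩
      have : KZ.of (T ((m : ℤ) + 1)) - ((m : ℤ) + 1) • KZ.of R =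
          (KZ.of (T ((m : ℤ) + 1)) - KZ.of (T m) - KZ.of R) + (KZ.of (T m) - (m : ℤ) • KZ.of R) := by
        rw [add_smul, one_smul]; abel
      rw [this]
      exact KZ.relations.add_mem h1 ih
    | pred m ih =>
      have h1 : KZ.of (T (-(m : ℤ))) - KZ.of (T (-(m : ℤ) - 1)) - KZ.of R ∈ KZ.relations :=
        KZ.integrandAddRel_subset_relations ⟨N, T (-(m : ℤ)), T (-(m : ℤ) - 1), R, rfl, rfl, fun x _ => by
          simp only [T, Pi.add_apply]; push_cast; ring, rfl⟩
      have : KZ.of (T (-(m : ℤ) - 1)) - (-(m : ℤ) - 1) • KZ.of R =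
          (KZ.of (T (-(m : ℤ))) - (-(m : ℤ)) • KZ.of R) - (KZ.of (T (-(m : ℤ))) - KZ.of (T (-(m : ℤ) - 1)) - KZ.of R) := by
        rw [sub_smul, one_smul]; abel
      rw [this]
      exact KZ.relations.sub_mem ih h1
  have h0 : KZ.of S - KZ.of (T n) ∈ KZ.relations :=
    KZ.of_sub_of_mem_relations_of_eqOn (by simp [T, hd]) fun x hx => by
      simp only [T]
      exact hi (hd ▸ hx)
  have : KZ.of S - n • KZ.of R = (KZ.of S - KZ.of (T n)) + (KZ.of (T n) - n • KZ.of R) := by abel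
  rw [this]
  exact KZ.relations.add_mem h0 (hT n)

/-- **Signed consolidation of representations with a common domain**: if `R.integrand = Σ_{l∈s} n_l · (Rs l).integrand`
on the common domain then `[R] − Σ_{l∈s} n_l • [Rs l] ∈ KZ.relations`. -/
theorem of_sub_sum_zsmul_mem_relations {N : ℕ} {ι : Type*} (s : Finset ι) (Rs : ι → KZ.IntegralRep N) (n : ι → ℤ) :
    ∀ (R : KZ.IntegralRep N), (∀ l ∈ s, (Rs l).domain = R.domain) →
      EqOn R.integrand (fun x => ∑ l ∈ s, (n l : ℝ) * (Rs l).integrand x) R.domain →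
      KZ.of R - ∑ l ∈ s, n l • KZ.of (Rs l) ∈ KZ.relations := by
  classical
  induction s using Finset.induction_on with
  | empty =>
    intro R _ hi
    simp only [Finset.sum_empty, sub_zero] at hi ⊢
    exact KZ.of_mem_relations_of_eqOn_zero R hi
  | insert a s ha ih =>
    intro R hd hi
    have hda : (Rs a).domain = R.domain := hd a (Finset.mem_insert_self a s)
    have hds : ∀ l ∈ s, (Rs l).domain = R.domain := fun l hl => hd l (Finset.mem_insert_of_mem hl)
    -- the partial representation `[D, Σ_{l∈s} n_l f_l]` and the summand `[D, n_a f_a]`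
    let R' : KZ.IntegralRep N :=
      { domain := R.domain, integrand := fun x => ∑ l ∈ s, (n l : ℝ) * (Rs l).integrand x,
        isSemialgebraic_domain := R.isSemialgebraic_domain,
        isSemialgebraicFunOn_integrand := KZ.isSemialgebraicFunOn_finset_sum s R.isSemialgebraic_domain fun l hl =>
          (IsSemialgebraicFunOn.mul_holds (isSemialgebraicFunOn_ratCast R.isSemialgebraic_domain (n l : ℚ))
            (hds l hl ▸ (Rs l).isSemialgebraicFunOn_integrand)).congr fun x _ => by simp,
        integrableOn := integrable_finsetSum s fun l hl =>
          (hds l hl ▸ (Rs l).integrableOn).const_mul (n l : ℝ) }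
    let Sa : KZ.IntegralRep N :=
      { domain := R.domain, integrand := fun x => (n a : ℝ) * (Rs a).integrand x,
        isSemialgebraic_domain := R.isSemialgebraic_domain,
        isSemialgebraicFunOn_integrand :=
          (IsSemialgebraicFunOn.mul_holds (isSemialgebraicFunOn_ratCast R.isSemialgebraic_domain (n a : ℚ))
            (hda ▸ (Rs a).isSemialgebraicFunOn_integrand)).congr fun x _ => by simp,
        integrableOn := (hda ▸ (Rs a).integrableOn).const_mul (n a : ℝ) }
    have h1 : KZ.of R - KZ.of R' - KZ.of Sa ∈ KZ.relations :=
      KZ.integrandAddRel_subset_relations ⟨N, R, R', Sa, rfl, rfl, fun x hx => by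
        rw [hi hx]; simp only [R', Sa, Finset.sum_insert ha, Pi.add_apply]; ring, rfl⟩
    have h2 : KZ.of R' - ∑ l ∈ s, n l • KZ.of (Rs l) ∈ KZ.relations := ih R' hds fun x _ => rfl
    have h3 : KZ.of Sa - n a • KZ.of (Rs a) ∈ KZ.relations :=
      of_zsmul_sub_mem_relations (n a) (Rs a) Sa hda.symm fun x _ => rfl
    rw [Finset.sum_insert ha]
    have : KZ.of R - (n a • KZ.of (Rs a) + ∑ l ∈ s, n l • KZ.of (Rs l)) =
        (KZ.of R - KZ.of R' - KZ.of Sa) + (KZ.of R' - ∑ l ∈ s, n l • KZ.of (Rs l)) +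
          (KZ.of Sa - n a • KZ.of (Rs a)) := by abel
    rw [this]
    exact KZ.relations.add_mem (KZ.relations.add_mem h1 h2) h3

/-- Fibre bound for the reversed regularised kernel by the LOGARITHM (`0 < w ≤ 1`, any order `m`):
`∫⁻_{[w,1]} ‖q (t−1)^m/t‖ ≤ ‖q · log w‖` (since `|t − 1| ≤ 1` on `[w, 1]`). -/
theorem lintegral_regKernel_le_log' (m : ℕ) (q : ℝ) {w : ℝ} (hw0 : 0 < w) (hw : w ≤ 1) :
    ∫⁻ t in Icc w 1, ‖q * ((t - 1) ^ m / t)‖ₑ ≤ ‖‖q * Real.log w‖‖ₑ := by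
  set g : ℝ → ℝ := fun t => q * ((t - 1) ^ m / t) with hg
  have hg_cont : ContinuousOn g (Icc w 1) := by
    have h := continuousOn_scaled_kernel m q 1 (Icc w 1)
      (fun t ht => (lt_of_lt_of_le hw0 ht.1).ne')
    simpa [hg] using h
  have hg_int : IntegrableOn g (Icc w 1) := hg_cont.integrableOn_compact isCompact_Icc
  have hL : ∫⁻ t in Icc w 1, ‖g t‖ₑ = ENNReal.ofReal (∫ t in Icc w 1, ‖g t‖) :=
    (ofReal_integral_norm_eq_lintegral_enorm hg_int).symm
  show ∫⁻ t in Icc w 1, ‖g t‖ₑ ≤ _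
  rw [hL, Real.enorm_eq_ofReal (norm_nonneg _)]
  refine ENNReal.ofReal_le_ofReal ?_
  have hpt : ∀ t ∈ Icc w 1, ‖g t‖ ≤ |q| * (t : ℝ)⁻¹ := by
    intro t ht
    have ht0 : 0 < t := lt_of_lt_of_le hw0 ht.1
    have h1 : |(t - 1) ^ m| ≤ 1 := by
      rw [abs_pow]
      exact pow_le_one₀ (abs_nonneg _) (by rw [abs_sub_comm, abs_of_nonneg (by linarith [ht.2])]; linarith [ht.1])
    simp only [hg, Real.norm_eq_abs, abs_mul, abs_div, abs_of_pos ht0]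
    rw [div_eq_mul_inv]
    calc |q| * (|(t - 1) ^ m| * t⁻¹) ≤ |q| * (1 * t⁻¹) := by gcongr
      _ = |q| * t⁻¹ := by rw [one_mul]
  have hcont2 : ContinuousOn (fun t : ℝ => |q| * t⁻¹) (Icc w 1) :=
    continuousOn_const.mul (continuousOn_id.inv₀ fun t ht => (lt_of_lt_of_le hw0 ht.1).ne')
  have hint2 : IntegrableOn (fun t : ℝ => |q| * t⁻¹) (Icc w 1) :=
    hcont2.integrableOn_compact isCompact_Icc
  calc ∫ t in Icc w 1, ‖g t‖ ≤ ∫ t in Icc w 1, |q| * t⁻¹ :=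
        setIntegral_mono_on hg_int.norm hint2 measurableSet_Icc hpt
    _ = |q| * (-Real.log w) := by
        rw [integral_Icc_eq_integral_Ioc, ← intervalIntegral.integral_of_le hw,
          intervalIntegral.integral_const_mul, integral_inv_of_pos hw0 one_pos, one_div, Real.log_inv]
    _ = ‖q * Real.log w‖ := by
        rw [norm_mul, Real.norm_eq_abs, Real.norm_eq_abs, abs_of_nonpos (Real.log_nonpos hw0.le hw)]

/-- **Honesty of the reversed regularised cell from the LOG bound** (`0 < W ≤ 1`, any order `m`): for `ℚ`-sa `q, W` on
`G` with `q·log W ∈ L¹(G)`, the cell `[band G W 1, q (t−1)^m/t]` EXISTS as an honest representation.  (Sharper than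
§3o′ `exists_regRep_of_integrableOn_pow'` at the ends where `W → 0`.) -/
theorem exists_regRep_of_integrableOn_log' {b m : ℕ} {G : Set (Fin b → ℝ)} {q W : (Fin b → ℝ) → ℝ}
    (hG : IsSemialgebraic ℚ G) (hq : IsSemialgebraicFunOn ℚ G q) (hW : IsSemialgebraicFunOn ℚ G W)
    (hW0 : ∀ x ∈ G, 0 < W x) (hW1 : ∀ x ∈ G, W x ≤ 1)
    (hint : IntegrableOn (fun x => q x * Real.log (W x)) G) :
    ∃ R : KZ.IntegralRep (b + 1), R.domain = KZlog.band G W (fun _ => 1) ∧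
      R.integrand = fun z => q (Fin.init z) * ((z (Fin.last b) - 1) ^ m / z (Fin.last b)) := by
  have h1sa : IsSemialgebraicFunOn ℚ G (fun _ => (1:ℝ)) :=
    (isSemialgebraicFunOn_ratCast hG 1).congr fun _ _ => by simp
  have hbsa : IsSemialgebraic ℚ (KZlog.band G W (fun _ => (1:ℝ))) := KZlog.isSemialgebraic_band hW h1sa
  have hGm : MeasurableSet G := hG.measurableSet_holds
  have hBm : MeasurableSet (KZlog.band G W (fun _ => (1:ℝ))) := hbsa.measurableSet_holds
  have hband_sub : KZlog.band G W (fun _ => (1:ℝ)) ⊆ {z : Fin (b + 1) → ℝ | Fin.init z ∈ G} :=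
    fun z hz => hz.1
  have hqI : IsSemialgebraicFunOn ℚ (KZlog.band G W (fun _ => (1:ℝ))) (fun z => q (Fin.init z)) :=
    hq.comp_init.mono hband_sub hbsa
  have hsI : IsSemialgebraicFunOn ℚ (KZlog.band G W (fun _ => (1:ℝ))) (fun z => z (Fin.last b)) :=
    Literature.NumberTheory.Transcendental.isSemialgebraicFunOn_apply hbsa (Fin.last b)
  have hs1 : IsSemialgebraicFunOn ℚ (KZlog.band G W (fun _ => (1:ℝ))) (fun z => z (Fin.last b) - 1) :=
    (IsSemialgebraicFunOn.sub_holds hsI (isSemialgebraicFunOn_ratCast hbsa 1)).congr fun z _ => by simp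
  have hs0 : ∀ z ∈ KZlog.band G W (fun _ => (1:ℝ)), z (Fin.last b) ≠ 0 := fun z hz => by
    have h1 : W (Fin.init z) ≤ z (Fin.last b) := hz.2.1
    exact (lt_of_lt_of_le (hW0 _ hz.1) h1).ne'
  have hRsa : IsSemialgebraicFunOn ℚ (KZlog.band G W (fun _ => (1:ℝ)))
      (fun z => q (Fin.init z) * ((z (Fin.last b) - 1) ^ m / z (Fin.last b))) :=
    IsSemialgebraicFunOn.mul_holds hqI
      (IsSemialgebraicFunOn.div (isSemialgebraicFunOn_pow' hbsa hs1 m) hsI hs0)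
  have hK : IntegrableOn (fun x => ‖q x * Real.log (W x)‖) G := hint.norm
  have hRint : IntegrableOn
      (fun z : Fin (b + 1) → ℝ => q (Fin.init z) * ((z (Fin.last b) - 1) ^ m / z (Fin.last b)))
      (KZlog.band G W (fun _ => (1:ℝ))) := by
    refine KZlog.integrableOn_band_of_lintegral_fibre_le hGm (a := W) (b := fun _ => (1:ℝ)) hBm
      (fun x t => KZlog.snoc_mem_band) (KZ.aestronglyMeasurable_of_isSemialgebraicFunOn hRsa hBm)
      (K := fun x => ‖q x * Real.log (W x)‖) (fun x hx => ?_) hK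
    simp only [Fin.init_snoc, Fin.snoc_last]
    exact lintegral_regKernel_le_log' m (q x) (hW0 x hx) (hW1 x hx)
  exact ⟨{ domain := KZlog.band G W (fun _ => (1:ℝ))
           integrand := fun z => q (Fin.init z) * ((z (Fin.last b) - 1) ^ m / z (Fin.last b))
           isSemialgebraic_domain := hbsa
           isSemialgebraicFunOn_integrand := hRsa
           integrableOn := hRint }, rfl, rfl⟩

/-- Parity bookkeeping for the base terms: `(−1)^{M−1−j} = −(−1)^M (−1)^j` for `j < M`. -/
theorem neg_one_pow_sub_sub {M j : ℕ} (hj : j < M) : (-1:ℝ) ^ (M - 1 - j) = -((-1) ^ M * (-1) ^ j) := by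
  obtain ⟨n, rfl⟩ : ∃ n, M = n + (j + 1) := ⟨M - 1 - j, by omega⟩
  have hjj : (-1:ℝ) ^ j * (-1) ^ j = 1 := by rw [← mul_pow]; simp
  rw [show n + (j + 1) - 1 - j = n by omega, pow_add, pow_succ]
  linear_combination (-(-1:ℝ) ^ n) * hjj

end CylLog
end RegularisedLogLayer
end Summit.KontsevichZagierPeriods.RootDecompRelativeModAbsolute.Rung30571
end
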